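import Literature.Probability.RandomPlanarGeometry.SAWTriangularPolygonJoinConstruction
import Literature.Probability.RandomPlanarGeometry.SAWTriangularPolygonJoinInjective
import Literature.Probability.RandomPlanarGeometry.SAWTriangularPolygonJoinCount
import Literature.Probability.RandomPlanarGeometry.SAWTriangularPolygonLoopEdges
import HarnessLib

/-!
# Madras' bound `q_N(𝕋) ≤ A·N^{−1/2}·μ(𝕋)^N` on the triangular lattice (LINE «TRI-MADRAS», final assembly)

Topic `Literature/Probability/RandomPlanarGeometry` (lane «pcv-sawmu»).  Continues and closes the chain
`SAWTriangularPolygonJoinCap` (cap rules) → `…JoinMerge` → `…JoinConstruction` (= JoinAssemble ⊕ JoinMirror ⊕ JoinMap ⊕ JoinDecoder: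
the five join constructions, first-contact glue, decoding) with `…JoinInjective` (cut uniqueness ⇒ equal re-rootings),
`…JoinCount` (the domain and its size), `…LoopEdges` (closing walks as polygons, translation rigidity), `…JoinSlide`
(first contact), `…TallThird` (`canonOf`), and `…JoinSpec` / `…MadrasBootstrap` (TREE: the bootstrap from the join inequality).

Source.  N. Madras, *A rigorous bound on the critical exponent for the number of lattice trees, animals, and polygons*, J. Stat.
Phys. 78 (1995) 681–699 [Madras1995LatticeAnimalsExponent], §2 (two dimensions: `p_n ≤ A n^{−1/2} μ^n`); recalled by A. Hammond,
arXiv:1504.05286 [Hammond2015SAPJoining], §2 p. 4 and §4.1 pp. 17–20 (arXiv v5).  There the lattice is `ℤ²`; this is the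
triangular-lattice edition (brick frame), with `K = 8` added edges.

## Contents (namespace `Literature.Probability.RandomPlanarGeometry.SAW`)
* `TriJoin.vshift`, `TriJoin.polyP`, `TriJoin.polyQ₀`, `TriJoin.JoinRel` — the positioned pair of a domain element and the join relation;
* `TriJoin.exists_joinRel`, `TriJoin.joinRel_mem`, `TriJoin.joinRel_inj`;
* **`joinMapSpecTri_holds`** — `JoinMapSpecTri (1/3) 8 N` for `N ≥ 3`;
* **`triPolygonNumber_le_rpow_half`** — `∃ A, ∀ N ≥ 1, q_N(𝕋) ≤ A · N^{−1/2} · μ(𝕋)^N` (Madras' `θ ≥ 1/2` on `𝕋`).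
-/

open Finset SimpleGraph Literature.Probability.LatticeModels Literature.Probability.Percolation
open Literature.Barriers.CriticalPhenomena.SupercriticalSAW (shiftEdges mem_shiftEdges_iff card_shiftEdges shiftEdges_injective)
open Literature.Probability.Percolation.SiteGadgetSystem (vertsOf mem_vertsOf)

namespace Literature.Probability.RandomPlanarGeometry.SAW

namespace TriJoin

open TriPolygon

/-- coordinates of a literal site. [folklore] -/
@[simp] private theorem uc0 (a b : ℤ) : (![a, b] : Site 2) 0 = a := rfl
/-- coordinates of a literal site. [folklore] -/
@[simp] private theorem uc1 (a b : ℤ) : (![a, b] : Site 2) 1 = b := rfl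

/-- the translation putting `σ` at vertical offset `τ` on the even sublattice. [cite: Madras1995LatticeAnimalsExponent, §2] -/
def vshift (τ : ℤ) : Site 2 := ![τ % 2, τ]

/-- the positioned left polygon of a domain element. [cite: Madras1995LatticeAnimalsExponent, §2] -/
def polyP (n : ℕ) (x : Σ _ : (ℕ → Site 2) × (ℕ → Site 2), ℤ) : Finset (Sym2 (Site 2)) := brickLoopEdges n x.1.1

/-- the positioned right polygon of a domain element, before sliding. [cite: Madras1995LatticeAnimalsExponent, §2] -/
def polyQ₀ (n : ℕ) (x : Σ _ : (ℕ → Site 2) × (ℕ → Site 2), ℤ) : Finset (Sym2 (Site 2)) :=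
  shiftEdges (vshift x.2) (brickLoopEdges n x.1.2)

/-- **The join relation**: `ζ` is the canonical traversal of a join witness of the domain element `x` (left polygon of `x`, right
polygon of `x` slid horizontally by a first-contact shift `s`). [cite: Madras1995LatticeAnimalsExponent, §2; Hammond2015SAPJoining, §4.1 (arXiv v5 pp. 17–20)] -/
def JoinRel (N : ℕ) (x : Σ _ : (ℕ → Site 2) × (ℕ → Site 2), ℤ) (ζ : ℕ → Site 2) : Prop :=
  ∃ (s : ℤ) (ρ : ℕ → Site 2), IsFirstContact (vertsOf (polyP (N - 1) x)) (vertsOf (polyQ₀ (N - 1) x)) s ∧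
    JoinWitness N (polyP (N - 1) x) (shiftEdges ![s, 0] (polyQ₀ (N - 1) x)) ρ ∧ ζ = canonOf (2 * (N + 4) - 1) ρ

variable {N : ℕ} {x y : Σ _ : (ℕ → Site 2) × (ℕ → Site 2), ℤ} {ζ : ℕ → Site 2}

/-- canonical traversals are closing walks. [cite: MadrasSlade1993, Definition 3.2.2] -/
private theorem loops_of_reps {n : ℕ} {ω : ℕ → Site 2} (h : ω ∈ triPolygonReps n) : ω ∈ loops n := by
  obtain ⟨hs, ha, -, -⟩ := mem_triPolygonReps.1 h
  exact mem_loops.2 ⟨hs, ha⟩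

/-- the positioned left polygon is a brick polygon with `N` edges whose vertices are on the even sublattice.
[cite: MadrasSlade1993, Definition 3.2.1] -/
private theorem polyP_facts (hN : 3 ≤ N) {ω : ℕ → Site 2} (hω : ω ∈ triPolygonReps (N - 1)) :
    IsPolygon brickGraph (brickLoopEdges (N - 1) ω) ∧ (brickLoopEdges (N - 1) ω).card = N ∧
      vertsOf (brickLoopEdges (N - 1) ω) = (range (N - 1 + 1)).image ω ∧
      ∀ t ∈ vertsOf (brickLoopEdges (N - 1) ω), (t 0 + t 1) % 2 = 0 := by
  have hl := loops_of_reps hω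
  have hs := (mem_loops.1 hl).1
  refine ⟨isPolygon_brickLoopEdges (by omega) hl, by rw [card_brickLoopEdges_of_mem_loops (by omega) hl]; omega,
    vertsOf_brickLoopEdges_of_mem_loops (by omega) hl, ?_⟩
  intro t ht
  rw [vertsOf_brickLoopEdges_of_mem_loops (by omega) hl, Finset.mem_image] at ht
  obtain ⟨i, -, rfl⟩ := ht
  exact even_of_mem_brickSaws hs i

/-- **Existence**: every domain element has a join. [cite: Madras1995LatticeAnimalsExponent, §2; Hammond2015SAPJoining, §4.1 (arXiv v5 pp. 17–20)] -/
theorem exists_joinRel (hN : 3 ≤ N) (hx : x ∈ joinDomain (N - 1)) : ∃ ζ, JoinRel N x ζ := by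
  obtain ⟨⟨ω, σ⟩, τ⟩ := x
  obtain ⟨hω, hσ, hτ⟩ := mem_joinDomain.1 hx
  simp only at hω hσ hτ
  have hωr := (mem_tallReps.1 hω).1
  obtain ⟨hPpoly, hPcard, hPverts, hPpar⟩ := polyP_facts hN hωr
  obtain ⟨hQpoly, hQcard, hQverts, hQpar⟩ := polyP_facts hN hσ
  set P := brickLoopEdges (N - 1) ω with hP
  set Q₀ := shiftEdges (vshift τ) (brickLoopEdges (N - 1) σ) with hQ₀
  have hQ₀par : ∀ w ∈ vertsOf Q₀, (w 0 + w 1) % 2 = 0 := by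
    intro w hw
    rw [hQ₀, mem_vertsOf_shiftEdges] at hw
    have := hQpar _ hw
    simp only [vshift, Pi.sub_apply, uc0, uc1] at this
    omega
  -- a first contact exists: the root row of `σ + vshift τ` is a row of `ω`
  obtain ⟨i, hi, hrow⟩ := mem_joinOffsets.1 hτ
  have hfc : ∃ s, IsFirstContact (vertsOf P) (vertsOf Q₀) s := by
    refine exists_isFirstContact ⟨ω i, ?_, σ 0 + vshift τ, ?_, ?_, ?_⟩
    · rw [hPverts, Finset.mem_image]; exact ⟨i, Finset.mem_range.2 (by omega), rfl⟩
    · rw [hQ₀, mem_vertsOf_shiftEdges, add_sub_cancel_right, hQverts, Finset.mem_image]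
      exact ⟨0, Finset.mem_range.2 (by omega), rfl⟩
    · simp only [Pi.add_apply, vshift, uc1]; omega
    · simp only [Pi.add_apply, vshift, uc1]; omega
  obtain ⟨s, hs⟩ := hfc
  set Q := shiftEdges ![s, 0] Q₀ with hQ
  have hQpoly' : IsPolygon brickGraph Q := isPolygon_shiftEdges_brick (isPolygon_shiftEdges_brick hQpoly _) _
  have hQcard' : Q.card = N := by rw [hQ, card_shiftEdges, hQ₀, card_shiftEdges, hQcard]
  have F1 : ∀ a ∈ vertsOf P, ∀ b ∈ vertsOf Q, b 1 ≤ a 1 + 2 → a 1 ≤ b 1 + 2 → a 0 ≤ b 0 := by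
    intro a ha b hb h1 h2
    rw [hQ, mem_vertsOf_shiftEdges] at hb
    have := le_of_isFirstContact hPpar hQ₀par hs ha hb (by simp only [Pi.sub_apply, uc1]; omega)
      (by simp only [Pi.sub_apply, uc1]; omega)
    simp only [Pi.sub_apply, uc0] at this; omega
  have F2 : ∃ a ∈ vertsOf P, ∃ b ∈ vertsOf Q, IsCloseShift a b 0 := by
    obtain ⟨a, ha, b, hb, hc⟩ := hs.1
    refine ⟨a, ha, b + ![s, 0], ?_, ?_⟩
    · rw [hQ, mem_vertsOf_shiftEdges, add_sub_cancel_right]; exact hb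
    · unfold TriPolygon.IsCloseShift at hc ⊢
      simp only [Pi.add_apply, uc0, uc1]
      omega
  obtain ⟨ρ, hρ⟩ := exists_joinWitness hPpoly hQpoly' hPcard hQcard' F1 F2
  exact ⟨_, s, ρ, hs, hρ, rfl⟩

/-- the join loop behind a witness: membership in `loops`, the cut at `0`, and the orientation.
[cite: Hammond2015SAPJoining, Definition 4.3 (arXiv v5 p. 20)] -/
private theorem witness_loop {P Q : Finset (Sym2 (Site 2))} {ρ : ℕ → Site 2} (h : JoinWitness N P Q ρ) :
    ρ ∈ loops (2 * (N + 4) - 1) ∧ IsRowSepCut (N + 4) (fun i => ρ (i % (2 * (N + 4)))) 0 ∧ ρ (N + 4 - 1) 0 = 1 := by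
  -- extract the loop data common to the five cases
  have key : ∃ u w : Site 2, (u = ![1, 1] ∧ w = ![3, 1] ∨ u = ![1, -1] ∧ w = ![3, -1]) ∧
      ρ ∈ loops (2 * (N + 4) - 1) ∧ ρ 0 = 0 ∧ ρ (N + 4 - 1) = u ∧ ρ (N + 4) = w ∧ ρ (2 * (N + 4) - 1) = ![2, 0] ∧
      (∀ a b : ℕ, a < N + 4 → N + 4 ≤ b → b < 2 * (N + 4) → ρ a 1 = ρ b 1 → ρ a 0 < ρ b 0) := by
    rcases h with ⟨_, -, -, -, -, -, hJ⟩ | ⟨_, -, -, -, -, -, -, -, -, hJ⟩ | ⟨_, -, -, -, -, -, -, hJ⟩ |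
        ⟨_, -, -, -, -, -, -, -, -, hJ⟩ | ⟨_, -, -, -, -, -, -, hJ⟩
    all_goals
      obtain ⟨-, hl, h0, hu, hw, hq, -, -, -, -, -, -, hsep⟩ := hJ
      first
        | exact ⟨_, _, Or.inl ⟨rfl, rfl⟩, hl, h0, hu, hw, hq, hsep⟩
        | exact ⟨_, _, Or.inr ⟨rfl, rfl⟩, hl, h0, hu, hw, hq, hsep⟩
  obtain ⟨u, w, huw, hl, h0, hu, hw, hq, hsep⟩ := key
  set M := N + 4 with hM
  have ev : ∀ i, i < 2 * M → (fun i => ρ (i % (2 * M))) i = ρ i := fun i hi => by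
    show ρ (i % (2 * M)) = ρ i; rw [Nat.mod_eq_of_lt hi]
  refine ⟨hl, ⟨⟨?_, ?_⟩, ⟨?_, ?_⟩, ⟨?_, ?_⟩, ?_⟩, ?_⟩
  · rw [ev _ (by omega), ev _ (by omega), show 0 + 2 * M - 1 = 2 * M - 1 by omega, hq, h0]; rfl
  · rw [ev _ (by omega), ev _ (by omega), show 0 + 2 * M - 1 = 2 * M - 1 by omega, hq, h0]; simp
  · rw [ev _ (by omega), ev _ (by omega), Nat.zero_add, hw, hu]
    rcases huw with ⟨rfl, rfl⟩ | ⟨rfl, rfl⟩ <;> rfl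
  · rw [ev _ (by omega), ev _ (by omega), Nat.zero_add, hw, hu]
    rcases huw with ⟨rfl, rfl⟩ | ⟨rfl, rfl⟩ <;> simp
  · rw [ev _ (by omega), ev _ (by omega), show 0 + M - 1 = M - 1 by omega, hu, h0]
    rcases huw with ⟨rfl, rfl⟩ | ⟨rfl, rfl⟩ <;> simp
  · rw [ev _ (by omega), ev _ (by omega), show 0 + M - 1 = M - 1 by omega, hu, h0]
    rcases huw with ⟨rfl, rfl⟩ | ⟨rfl, rfl⟩ <;> simp
  · intro a b _ ha hb1 hb2 hrow
    rw [ev a (by omega), ev b (by omega)] at hrow ⊢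
    exact hsep a b (by omega) (by omega) (by omega) hrow
  · rw [hu]; rcases huw with ⟨rfl, rfl⟩ | ⟨rfl, rfl⟩ <;> rfl

/-- **The join lands in the canonical traversals of the `(2N+8)`-gons.** [cite: MadrasSlade1993, Definition 3.2.2; Madras1995LatticeAnimalsExponent, §2] -/
theorem joinRel_mem (h : JoinRel N x ζ) : ζ ∈ triPolygonReps (2 * N + 8 - 1) := by
  obtain ⟨s, ρ, -, hW, rfl⟩ := h
  obtain ⟨hl, -, -⟩ := witness_loop hW
  have := (canonOf_spec (by omega) hl).1
  rwa [show 2 * (N + 4) - 1 = 2 * N + 8 - 1 by omega] at this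

/-- **Injectivity of the join.** [cite: Madras1995LatticeAnimalsExponent, §2 (the join is injective; primary, not held by the lane); Hammond2015SAPJoining, §3.2 p. 10 and §4.4 p. 27, (4.9) (arXiv v5: the join polygon and its junction plaquette determine the two halves)] -/
theorem joinRel_inj (hN : 3 ≤ N) (hx : x ∈ joinDomain (N - 1)) (hy : y ∈ joinDomain (N - 1))
    (h₁ : JoinRel N x ζ) (h₂ : JoinRel N y ζ) : x = y := by
  obtain ⟨⟨ω₁, σ₁⟩, τ₁⟩ := x
  obtain ⟨⟨ω₂, σ₂⟩, τ₂⟩ := y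
  obtain ⟨hω₁, hσ₁, -⟩ := mem_joinDomain.1 hx
  obtain ⟨hω₂, hσ₂, -⟩ := mem_joinDomain.1 hy
  simp only at hω₁ hσ₁ hω₂ hσ₂
  have hω₁r := (mem_tallReps.1 hω₁).1
  have hω₂r := (mem_tallReps.1 hω₂).1
  obtain ⟨s₁, ρ₁, -, hW₁, hζ₁⟩ := h₁
  obtain ⟨s₂, ρ₂, -, hW₂, hζ₂⟩ := h₂
  simp only [polyP, polyQ₀] at hW₁ hW₂
  -- the two loops are re-rootings of the same canonical traversal with cuts at 0: they are equal
  obtain ⟨hl₁, c₁, o₁⟩ := witness_loop hW₁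
  obtain ⟨hl₂, c₂, o₂⟩ := witness_loop hW₂
  obtain ⟨hζr, r₁, hr₁, b₁, e₁⟩ := canonOf_spec (by omega) hl₁
  obtain ⟨-, r₂, hr₂, b₂, e₂⟩ := canonOf_spec (by omega) hl₂
  rw [← hζ₁] at hζr e₁
  rw [← hζ₂] at e₂
  have hρ : ρ₁ = ρ₂ :=
    eq_of_unroot_of_cuts (M := N + 4) (by omega) (loops_of_reps hζr) hr₁ hr₂ e₁ e₂ c₁ c₂ o₁ o₂
  subst hρ
  -- decode: the positioned pairs are common translates
  obtain ⟨hP₁, -, -, -⟩ := polyP_facts hN hω₁r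
  obtain ⟨hP₂, -, -, -⟩ := polyP_facts hN hω₂r
  obtain ⟨hQ₁, -, -, -⟩ := polyP_facts hN hσ₁
  obtain ⟨hQ₂, -, -, -⟩ := polyP_facts hN hσ₂
  obtain ⟨z, hPz, hQz⟩ := JoinWitness.translate hP₁
    (isPolygon_shiftEdges_brick (isPolygon_shiftEdges_brick hQ₁ _) _) hP₂
    (isPolygon_shiftEdges_brick (isPolygon_shiftEdges_brick hQ₂ _) _) hW₁ hW₂
  -- left: canonical traversals are translation-rigid
  obtain ⟨hω, hz⟩ := eq_of_shiftEdges_brickLoopEdges (by omega) hω₁r hω₂r hPz.symm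
  subst hz
  -- right: the same, after collecting the translations
  rw [shiftEdges_zero, shiftEdges_shiftEdges, shiftEdges_shiftEdges] at hQz
  have hQ' : shiftEdges (vshift τ₂ + ![s₂, 0] - (vshift τ₁ + ![s₁, 0])) (brickLoopEdges (N - 1) σ₂) =
      brickLoopEdges (N - 1) σ₁ := by
    have := congrArg (shiftEdges (-(vshift τ₁ + ![s₁, 0]))) hQz
    rw [shiftEdges_shiftEdges, shiftEdges_shiftEdges, add_neg_cancel, shiftEdges_zero, ← sub_eq_add_neg] at this
    exact this
  obtain ⟨hσ, hv⟩ := eq_of_shiftEdges_brickLoopEdges (by omega) hσ₂ hσ₁ hQ'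
  have hτ : τ₁ = τ₂ := by
    have := congrFun hv 1
    simp only [vshift, Pi.sub_apply, Pi.add_apply, Pi.zero_apply, uc1] at this
    omega
  subst hω; subst hτ
  rw [hσ]

end TriJoin

open TriJoin TriPolygon in
/-- **The join-map specification holds on `𝕋` with `c = 1/3`, `K = 8`, for every `N ≥ 3`.**
[cite: Madras1995LatticeAnimalsExponent, §2; Hammond2015SAPJoining, §4.1 (arXiv v5 pp. 17–20)] -/
theorem joinMapSpecTri_holds {N : ℕ} (hN : 3 ≤ N) : JoinMapSpecTri (1 / 3) 8 N := by
  classical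
  let Ψ : (Σ _ : (ℕ → Site 2) × (ℕ → Site 2), ℤ) → (ℕ → Site 2) :=
    fun x => if h : ∃ ζ, JoinRel N x ζ then h.choose else fun _ => 0
  have hΨ : ∀ x ∈ joinDomain (N - 1), JoinRel N x (Ψ x) := by
    intro x hx
    have h := exists_joinRel hN hx
    simp only [Ψ, dif_pos h]
    exact h.choose_spec
  refine joinMapSpecTri_of_injOn (by omega) Ψ (fun x hx => ?_) (fun x hx y hy hxy => ?_)
  · have := joinRel_mem (hΨ x hx)
    rwa [show 2 * N + 8 - 1 = 2 * N + 8 - 1 from rfl] at this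
  · exact joinRel_inj hN (Finset.mem_coe.1 hx) (Finset.mem_coe.1 hy) (hΨ x hx) (hxy ▸ hΨ y hy)

/-- **Madras' bound on the triangular lattice (`θ ≥ 1/2`)**: there is a constant `A` with
`q_N(𝕋) ≤ A · N^{−1/2} · μ(𝕋)^N` for every `N ≥ 1`, where `q_N(𝕋) = triPolygonNumber N` counts `N`-step self-avoiding polygons of
the triangular lattice up to translation and `μ(𝕋) = exp logMuTri` is its connective constant.
[cite: Madras1995LatticeAnimalsExponent, §2 (two dimensions: `p_n ≤ A n^{−1/2} μ^n`); Hammond2015SAPJoining, §2 p. 4 (arXiv v5)] -/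
theorem triPolygonNumber_le_rpow_half :
    ∃ A : ℝ, ∀ N : ℕ, 1 ≤ N →
      (triPolygonNumber N : ℝ) ≤ A * (N : ℝ) ^ (-(1 / 2 : ℝ)) * Real.exp logMuTri ^ N :=
  triPolygonNumber_le_rpow_of_joinMapSpec (c := 1 / 3) (K := 8) (N₀ := 3) (by norm_num)
    (fun _ hN => joinMapSpecTri_holds hN)

end Literature.Probability.RandomPlanarGeometry.SAW
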